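import Summits.QuantumFields.BalabanUV.Beta.D1BFx.StraightPinVertexFamilies

/-!
# `BalabanUV.Beta.D1BFx.RoadPinVertexFamilies` — road «BF-x» for binder row D1, slot (K), PART 24 HEAD «TWO PINS» ((H3-Δ) word list `ChartDefectTwoPins.chartDefect_record_eq_words`,
# the Λ-sector FACE row `W^{Λ}_f = Wmix(Λf[G₀]; V_{S♭}[G₀]) − Wmix(Λf[G₀]; V_{S⁰}[G₀])` located by the OWNER d1-p2 g25, l.53648), «G0-VF-PACK»:
# **THE ROAD-PIN (bm-DRESSED) FIRST-ORDER VERTEX FAMILIES `V[G₀] := vertexOfK G₀ n S`, `G₀ = coDressKBmAt ρ n K₀`, IN `VertexFamily` CURRENCY WITH THE POWER DISPLAYED** —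
# FILE 1's K-generic column-envelope lemma fed this lineage's g53 «G0-COL-ENV» `PackedColumnEnvelope.abs_colH_G₀_road_le` (the located count `(n⁴)⁻¹`, UNCONDITIONAL), then the
# record's `S♭ ∕ S⁰ ∕ SΛ` letters of FILE 1 — hypothesis-free «`G₀`-column families» for the face-gauge bracket (leaf-03's TT10 `biLoc_faceGauge` lineage prices the bracket itself)

HONEST DEPENDENCY (cell records, verbatim): «continuum YM on T⁴ ⇐ BetaPertH ∧ nine spine estimates (0/9 proved); BetaPertH ⇐ (D1) ∧ (D4) ∧
CAP+tail; G-an2-4 gates asym, D1 and NE2/3/4.»  HONEST FRAMING (cell contract, verbatim): «discharging `BetaPertH` makes Bałaban's UV stability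
UNCONDITIONAL — a real constructive-QFT result; it is NOT the continuum limit and NOT the Clay problem.»  THIS MODULE DISCHARGES NOTHING of the
wall: [folklore] sup-entry bookkeeping BY NAME over LANDED objects (FILE 1 `StraightPinVertexFamilies.vertexFamily_vertexOfK_of_colH ∕ locStencil_Sflat_record ∕
locStencil_SLam_record ∕ locStencil_S_zero_record`; g53 `PackedColumnEnvelope.abs_colH_G₀_road_le`).  No definition, no `def … : Prop`, nothing cited, 0 sorry.  Nothing of the
tables or of Bałaban's is asserted; NO (1.22) row is proved; 0 root-level binders of row D1 discharged (hW ∕ hR-sockets ∕ hSX-socket ∕ D1Tel ∕ D1Rep = 0); (J1) ONE OPEN ROW; (K) NOT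
closed; NOT D1, NEVER «G-an2-4 closed», NOT `BetaPertH`, NOT continuum, NOT Clay.

ABSOLUTE RULE (cell charter, verbatim): «No internally-minted statement may enter as a cited fact. Every hypothesis is either kernel-proved in
this package or a verbatim quotation of a PUBLISHED theorem with page reference. The manuscript(s) under audit are NOT citable for their own
disputed steps — they are the thing under adjudication; programme-internal (2001/route/tribunal) claims are never citable.»

WHY.  The (H3-Δ) word list keeps the FACE Λ-sector word `½·tadpole G₀ (W^{Λ}_f μ 0 ν z)` with `W^{Λ}_f = Wmix(Λf[G₀]; vertexOfK G₀ n S♭) − Wmix(Λf[G₀]; vertexOfK G₀ n S⁰)` —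
families at the ROAD pin `G₀ = coDressKBmAt ρ_c n K₀`, not at `K₀` (the column word `W^{Λ}_c` cancels between the pins; OWNER d1-p2 g25 l.53648).  Its letter is a face-gauge
generator (leaf-03 TT10) × a `G₀`-COLUMN vertex family; the latter exists in the tree only existentially (`vertexFamily_vertexOfK'` over `decays_coDressKBmAt`-class letters).
FILE 1 §1 takes ANY column envelope, and the dressed column's is g53's UNCONDITIONAL «G0-COL-ENV» (`(n⁴)⁻¹·C₄(1 + 8(1 + e^{κ′}))e^{κ′}`, rate `κ′∕(4n)`; the count `n⁻⁴` — one power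
WORSE than the straight column's `n⁻⁵`, F-g23-1's face sheets — is displayed, not hidden), so the `G₀` families come out with every constant in place; the multiplier-column
vertex `V_H = vertexOfM · n (symHessFFAt ρ_c n)` of the mixed row is FILE 1 §2 over an1's (LH), identical at both pins (`colM_coDressKBmAt`) — §3.

CONTENT (`K₀ := KInvStep 3 n 0`, `G₀(r) := coDressKBmAt (toSite r) n K₀` for an in-block root `r ∈ box 4 n`, the record's `ρ_c = ctr 4 n = toSite (ctrOff 4 n)`;
`C_G := (n⁴)⁻¹·(C₄·(1 + 8·(1 + e^{κ′}))·e^{κ′})`, `C₄ := MG163 4·periodConst (kappa163 4) 3`, `κ′ := kappa163 4 ∕ 4`).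
* §1 **`abs_colH_G₀_road_le'`** (g53's letter restated for `[NeZero n]` instead of `n = m + 1` — a re-indexing, same bytes of content), **`vertexFamily_vertexOfK_G₀`** (any root
  `r ∈ box 4 n`, any `LocStencil S Cs δ`, `0 < δ ≤ κ′∕(4n)` ⟹ `VertexFamily (vertexOfK (G₀ r) n S) n (4·(C_G·Cs·Zl 4 (δ∕2))) (δ∕2)`).
* §2 AT THE RECORD's ROOT `ρ_c`, HYPOTHESIS-FREE: **`vertexFamily_vertexOfK_G₀_Sflat_record`** (rate `δ∕2`), **`vertexFamily_vertexOfK_G₀_SLam_record`** (rate `δ∕4`),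
  **`vertexFamily_vertexOfK_G₀_S_zero_record`** (rate `δ∕4`) — FILE 1's `locStencil_*_record` letters through §1.
* §3 THE HEAD's `V_H := vertexOfM · n (symHessFFAt ρ_c n)` (modulo `hΦ`): **`vertexFamily_vertexOfM_K₀_symHessFFAt_record`**, **`vertexFamily_vertexOfM_G₀_symHessFFAt_record`**
  (same letter — co-dressing does not touch the multiplier columns, an1's `colM_coDressKBmAt`).
NOT HERE (honest): the face-gauge bracket `Wmix(Λf[G₀]; ·)` itself (leaf-03 TT10's `biLoc_faceGauge` lineage ∕ the HEAD); any (1.22) row; whether `n⁻⁴ × (FILE 1's stencil constants) ×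
Zl 4 (δ∕2)` closes a row n-free.
Unit `b2b-balaban-gan24-formalise-leaf-05` (gen 62), G-an2-4 swarm leaf prover 05, road «BF-x» supplier; INTENT-3 «G0-VF-PACK» (journal [GAN24LEAF05-G62-INTENT-3]).  No existing file touched.
-/

noncomputable section

open Literature.MathematicalPhysics.QuantumFieldTheory
open Literature.MathematicalPhysics.QuantumFieldTheory.Balaban1983to89
open Literature.MathematicalPhysics.QuantumFieldTheory.Balaban1983to89.Beta
open B12Sec2to5 (l1 l1_nonneg)
open B5Hk163Strip (kappa163 kappa163_pos)
open B5Hk163Decay (MG163)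
open B4TorusKernel (periodConst)
open B4ContourShift (supNorm)
open ExpKernelCalculus (Site MKer Zl BiLoc VertexFamily)
open AffineAveraging (box toSite)
open AveragingContoursRooted (ctr ctrOff ctrOff_mem_box)
open AveragingHessianKernels (ell)
open OneStepResolventKernel (Fib KInv LocStencil)
open OneStepKernelFamily (colH KInvStep vertexOfK)
open InterLevelTransport (SLam)
open SecondOrderResponse (colM vertexOfM)
open KernelSpecInstance (wΦ)
open StepJetData (wilsonA wBound)
open BalabanStepJets (lamCoeffOf)
open Summit.QuantumFields.BalabanUV.Beta.AxialDressingRooted (coDressKBmAt)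
open Summit.QuantumFields.BalabanUV.Beta.SymAveragingHessianCounts (symVhSAt symHessFFAt vertexFamily_symHessFFAt)
open Summit.QuantumFields.BalabanUV.Beta.KernelWardMColumn (colM_coDressKBmAt)
open Summit.QuantumFields.BalabanUV.Beta.SymSecondOrderTablesAn1 (symTablesAn1S2)
open Summit.QuantumFields.BalabanUV.Beta.CombChartStepJets (JsB12CombSh0)
open Summit.QuantumFields.BalabanUV.Beta.D1BFx.PackedColumnEnvelope (abs_colH_G₀_road_le)
open Summit.QuantumFields.BalabanUV.Beta.D1BFx.StraightPinVertexFamilies (vertexFamily_vertexOfK_of_colH locStencil_Sflat_record locStencil_SLam_record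
  locStencil_S_zero_record vertexFamily_vertexOfM_K₀_of_wΦ)

namespace Summit.QuantumFields.BalabanUV.Beta.D1BFx.RoadPinVertexFamilies

variable (n : ℕ) [NeZero n]

/-! ## §1 The dressed column's envelope for `[NeZero n]`; the road-pin vertex family -/

/-- [folklore] **«G0-COL-ENV» AT A GENERIC BLOCKING `n ≠ 0`** (g53 `PackedColumnEnvelope.abs_colH_G₀_road_le`, stated there at `n = m + 1`, re-indexed): for every in-block root
`r ∈ box 4 n`, `|colH (coDressKBmAt (toSite r) n K₀) n μ y κ u| ≤ ((n⁴)⁻¹·(C₄·(1 + 8(1 + e^{κ′}))·e^{κ′}))·e^{−(κ′∕(4n))|u − n•y|₁}` — UNCONDITIONAL, the located count `n⁻⁴`. -/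
theorem abs_colH_G₀_road_le' {r : Fin (3 + 1) → ℕ} (hr : r ∈ box (3 + 1) n) (μ : Fin (3 + 1)) (y : Fin (3 + 1) → ℤ) (κ : Fin (3 + 1))
    (u : Fin (3 + 1) → ℤ) :
    |colH (coDressKBmAt (toSite r) n (KInvStep (d := 3) n 0)) n μ y κ u|
      ≤ ((((n : ℕ) : ℝ) ^ 4)⁻¹ * ((MG163 4 * periodConst (kappa163 4) 3)
          * (1 + 8 * (1 + Real.exp (kappa163 4 / 4))) * Real.exp (kappa163 4 / 4)))
        * Real.exp (-(kappa163 4 / 4 / (4 * ((n : ℕ) : ℝ))) * l1 (u - ((n : ℕ) : ℤ) • y)) := by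
  obtain ⟨m, rfl⟩ : ∃ m, n = m + 1 := ⟨n - 1, (Nat.succ_pred_eq_of_pos (Nat.pos_of_ne_zero (NeZero.ne n))).symm⟩
  exact abs_colH_G₀_road_le m hr μ y κ u

/-- [folklore] **A ROAD-PIN FIRST-JET FAMILY IS A VERTEX FAMILY, THE DRESSED COLUMN's `(n⁴)⁻¹` DISPLAYED**: for every in-block root `r ∈ box 4 n`, every local stencil family `S`
(`LocStencil S Cs δ`) at a rate `0 < δ ≤ κ′∕(4n)`, `VertexFamily (vertexOfK (coDressKBmAt (toSite r) n K₀) n S) n (4·(C_G·Cs·Zl 4 (δ∕2))) (δ∕2)` — FILE 1 §1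
`vertexFamily_vertexOfK_of_colH` over §1's envelope. -/
theorem vertexFamily_vertexOfK_G₀ {r : Fin (3 + 1) → ℕ} (hr : r ∈ box (3 + 1) n) {S : Fin (3 + 1) → (Fin (3 + 1) → ℤ) → MKer 4 (Fib 3)} {Cs δ : ℝ}
    (hS : LocStencil S Cs δ) (hδ : 0 < δ) (hδK : δ ≤ kappa163 4 / 4 / (4 * (n : ℝ))) :
    VertexFamily (vertexOfK (coDressKBmAt (toSite r) n (KInvStep (d := 3) n 0)) n S) n
      (4 * ((((n : ℝ) ^ 4)⁻¹ * ((MG163 4 * periodConst (kappa163 4) 3) * (1 + 8 * (1 + Real.exp (kappa163 4 / 4))) * Real.exp (kappa163 4 / 4)))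
        * Cs * Zl 4 (δ / 2))) (δ / 2) := by
  have hcol := fun (μ : Fin (3 + 1)) (y : Fin (3 + 1) → ℤ) (κ' : Fin (3 + 1)) (u : Fin (3 + 1) → ℤ) => abs_colH_G₀_road_le' n hr μ y κ' u
  have hC : 0 ≤ (((n : ℝ) ^ 4)⁻¹ * ((MG163 4 * periodConst (kappa163 4) 3) * (1 + 8 * (1 + Real.exp (kappa163 4 / 4))) * Real.exp (kappa163 4 / 4))) := by
    have h0 := (abs_nonneg _).trans (hcol 0 0 0 0)
    exact (mul_nonneg_iff_of_pos_right (Real.exp_pos _)).1 h0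
  have h := vertexFamily_vertexOfK_of_colH (N := n) (K := coDressKBmAt (toSite r) n (KInvStep (d := 3) n 0)) hcol hC hS hδ hδK
  have e4 : ((3 + 1 : ℕ) : ℝ) = 4 := by norm_num
  rw [e4] at h
  exact h

/-! ## §2 The record's families at the road pin `G₀ = coDressKBmAt ρ_c n K₀`, hypothesis-free -/

/-- [folklore] **`V_{S♭}[G₀] := vertexOfK G₀ n S♭` AT THE RECORD IS A VERTEX FAMILY, HYPOTHESIS-FREE, CONSTANT DISPLAYED** (`0 < δ ≤ κ′∕(4n)`; §1 at the centred root `ctrOff 4 n`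
over FILE 1 `locStencil_Sflat_record`): rate `δ∕2` — a `G₀`-column family of the HEAD's face row `W^{Λ}_f`. -/
theorem vertexFamily_vertexOfK_G₀_Sflat_record {δ : ℝ} (hδ : 0 < δ) (hδK : δ ≤ kappa163 4 / 4 / (4 * (n : ℝ))) :
    VertexFamily (vertexOfK (coDressKBmAt (ctr 4 n) n (KInvStep (d := 3) n 0)) n
        (fun κ u => ((n : ℝ) ^ 4) • wilsonA 3 κ u + (-((n : ℝ) ^ 8 / 2)) • symVhSAt (ctr 4 n) 3 n rfl κ u)) n
      (4 * ((((n : ℝ) ^ 4)⁻¹ * ((MG163 4 * periodConst (kappa163 4) 3) * (1 + 8 * (1 + Real.exp (kappa163 4 / 4))) * Real.exp (kappa163 4 / 4)))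
        * ((n : ℝ) ^ 4 * (wBound 3 * Real.exp (4 * δ))
            + (n : ℝ) ^ 8 / 2 * (3 * (ell (3 + 1) n : ℝ) ^ 2 * Real.exp (4 * ((3 : ℝ) + 1) * n * δ)))
        * Zl 4 (δ / 2))) (δ / 2) := by
  have hn1 : 1 ≤ n := Nat.one_le_iff_ne_zero.2 (NeZero.ne n)
  exact vertexFamily_vertexOfK_G₀ n (ctrOff_mem_box hn1) (locStencil_Sflat_record n hδ.le) hδ hδK

/-- [folklore] **`V_{SΛ}[G₀] := vertexOfK G₀ n (SLam n (lamCoeffOf (KInv n) n) (symHessFFAt ρ_c n))` AT THE RECORD IS A VERTEX FAMILY, HYPOTHESIS-FREE, CONSTANT DISPLAYED**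
(`0 < δ ≤ κ′∕(4n)`; §1 over FILE 1 `locStencil_SLam_record` at rate `δ∕2`): rate `δ∕4`, the dressed column's `(n⁴)⁻¹` and the one-shot coefficients' `(n⁵)⁻¹` both visible. -/
theorem vertexFamily_vertexOfK_G₀_SLam_record {δ : ℝ} (hδ : 0 < δ) (hδK : δ ≤ kappa163 4 / 4 / (4 * (n : ℝ))) :
    VertexFamily (vertexOfK (coDressKBmAt (ctr 4 n) n (KInvStep (d := 3) n 0)) n
        (SLam n (lamCoeffOf (KInv (N := n)) n) (symHessFFAt (ctr 4 n) n))) n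
      (4 * ((((n : ℝ) ^ 4)⁻¹ * ((MG163 4 * periodConst (kappa163 4) 3) * (1 + 8 * (1 + Real.exp (kappa163 4 / 4))) * Real.exp (kappa163 4 / 4)))
        * (((3 + 1 : ℕ) : ℝ) * (((((n : ℝ) ^ 5)⁻¹ * ((3 : ℝ) ^ (3 + 1) * ((3 + 1 : ℕ) : ℝ) * (16 * ((3 + 1 : ℕ) : ℝ)) * (MG163 4 * periodConst (kappa163 4) 3)
            * Real.exp (kappa163 4 / 4) * Real.exp (kappa163 4 / 4) * Real.exp (kappa163 4 / 4))) * Real.exp (kappa163 4 / 4))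
          * (2 * (ell (3 + 1) n : ℝ) ^ 2 * Real.exp (4 * ((3 : ℝ) + 1) * n * δ)) * Zl (3 + 1) (δ / 2)))
        * Zl 4 (δ / 2 / 2))) (δ / 2 / 2) := by
  have hn1 : 1 ≤ n := Nat.one_le_iff_ne_zero.2 (NeZero.ne n)
  exact vertexFamily_vertexOfK_G₀ n (ctrOff_mem_box hn1) (locStencil_SLam_record n hδ hδK) (half_pos hδ) ((half_le_self hδ.le).trans hδK)

/-- [folklore] **`V^s[G₀] := vertexOfK G₀ n S⁰` AT THE RECORD IS A VERTEX FAMILY, HYPOTHESIS-FREE, CONSTANT DISPLAYED** (`0 < δ ≤ κ′∕(4n)`; §1 over FILE 1 `locStencil_S_zero_record`):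
rate `δ∕4` — the other `G₀`-column family of the HEAD's face row `W^{Λ}_f`. -/
theorem vertexFamily_vertexOfK_G₀_S_zero_record (hodd : Odd n) (N : ℕ) (cM cΛ cB : ℝ) {δ : ℝ} (hδ : 0 < δ)
    (hδK : δ ≤ kappa163 4 / 4 / (4 * (n : ℝ))) :
    VertexFamily (vertexOfK (coDressKBmAt (ctr 4 n) n (KInvStep (d := 3) n 0)) n (JsB12CombSh0 hodd N (symTablesAn1S2 3 n cM) cΛ cB 0).S) n
      (4 * ((((n : ℝ) ^ 4)⁻¹ * ((MG163 4 * periodConst (kappa163 4) 3) * (1 + 8 * (1 + Real.exp (kappa163 4 / 4))) * Real.exp (kappa163 4 / 4)))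
        * (((n : ℝ) ^ 4 * (wBound 3 * Real.exp (4 * (δ / 2)))
              + (n : ℝ) ^ 8 / 2 * (3 * (ell (3 + 1) n : ℝ) ^ 2 * Real.exp (4 * ((3 : ℝ) + 1) * n * (δ / 2))))
            + |cΛ| * (((3 + 1 : ℕ) : ℝ) * (((((n : ℝ) ^ 5)⁻¹ * ((3 : ℝ) ^ (3 + 1) * ((3 + 1 : ℕ) : ℝ) * (16 * ((3 + 1 : ℕ) : ℝ)) * (MG163 4 * periodConst (kappa163 4) 3)
                * Real.exp (kappa163 4 / 4) * Real.exp (kappa163 4 / 4) * Real.exp (kappa163 4 / 4))) * Real.exp (kappa163 4 / 4))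
              * (2 * (ell (3 + 1) n : ℝ) ^ 2 * Real.exp (4 * ((3 : ℝ) + 1) * n * δ)) * Zl (3 + 1) (δ / 2))))
        * Zl 4 (δ / 2 / 2))) (δ / 2 / 2) := by
  have hn1 : 1 ≤ n := Nat.one_le_iff_ne_zero.2 (NeZero.ne n)
  exact vertexFamily_vertexOfK_G₀ n (ctrOff_mem_box hn1) (locStencil_S_zero_record n hodd N cM cΛ cB hδ hδK) (half_pos hδ)
    ((half_le_self hδ.le).trans hδK)

/-! ## §3 The HEAD's Hessian-table multiplier vertex `V_H := vertexOfM · n (symHessFFAt ρ_c n)` at both pins (modulo `hΦ`) -/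

/-- [folklore] **`V_H[K₀] := vertexOfM K₀ n (symHessFFAt ρ_c n)` IS A VERTEX FAMILY, `(n⁵)⁻¹·(n³)⁻¹` DISPLAYED** (modulo the displayed `hΦ`, `0 < κ₀`; `0 < δ ≤ κ₀∕(4n)`;
FILE 1 §2 `vertexFamily_vertexOfM_K₀_of_wΦ` over an1's (LH) `vertexFamily_symHessFFAt` at the centred root): rate `δ∕2`, constant
`4·((CΦ·(n⁵)⁻¹·(n³)⁻¹·e^{κ₀})·(2·ell(4,n)²·e^{16nδ})·Zl 4 (δ∕2))` — the `V_H` of the (H3-Δ) mixed row `½·tadpole G₀ (Wmix(Λ′_c; V_H))` (OWNER W-g25-1, `Mt := symHessFFAt ρ_c n`, `ξ := 1`). -/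
theorem vertexFamily_vertexOfM_K₀_symHessFFAt_record {CΦ κ₀ : ℝ} (hκ₀ : 0 < κ₀)
    (hΦ : ∀ (ρ ν : Fin (3 + 1)) (w : Fin (3 + 1) → ℤ),
      |wΦ (N := n) ρ ν w| ≤ CΦ * ((n : ℝ) ^ 5)⁻¹ * ((n : ℝ) ^ 3)⁻¹ * Real.exp (-(κ₀ * supNorm w)))
    {δ : ℝ} (hδ : 0 < δ) (hδ₀ : δ ≤ κ₀ / (4 * (n : ℝ))) :
    VertexFamily (vertexOfM (KInvStep (d := 3) n 0) n (symHessFFAt (ctr 4 n) n)) n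
      (4 * ((CΦ * ((n : ℝ) ^ 5)⁻¹ * ((n : ℝ) ^ 3)⁻¹ * Real.exp κ₀)
        * (2 * (ell (3 + 1) n : ℝ) ^ 2 * Real.exp (4 * ((3 : ℝ) + 1) * n * δ)) * Zl 4 (δ / 2))) (δ / 2) := by
  have hn1 : 1 ≤ n := Nat.one_le_iff_ne_zero.2 (NeZero.ne n)
  exact vertexFamily_vertexOfM_K₀_of_wΦ n hκ₀ hΦ (vertexFamily_symHessFFAt (d := 3) hn1 (ctrOff_mem_box hn1) hδ.le) hδ hδ₀

/-- [folklore] **`V_H[G₀] := vertexOfM G₀ n (symHessFFAt ρ_c n)` AT THE ROAD PIN IS THE SAME VERTEX FAMILY** (co-dressing does not touch the multiplier columns —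
an1's `KernelWardMColumn.colM_coDressKBmAt`, so `vertexOfM G₀ n M = vertexOfM K₀ n M` entrywise; leaf-01 TT16's `vertexOfM_coDress_eq` is the same fact): same constant and rate as
`vertexFamily_vertexOfM_K₀_symHessFFAt_record` — the spelling the (H3-Δ) word list uses. -/
theorem vertexFamily_vertexOfM_G₀_symHessFFAt_record {CΦ κ₀ : ℝ} (hκ₀ : 0 < κ₀)
    (hΦ : ∀ (ρ ν : Fin (3 + 1)) (w : Fin (3 + 1) → ℤ),
      |wΦ (N := n) ρ ν w| ≤ CΦ * ((n : ℝ) ^ 5)⁻¹ * ((n : ℝ) ^ 3)⁻¹ * Real.exp (-(κ₀ * supNorm w)))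
    {δ : ℝ} (hδ : 0 < δ) (hδ₀ : δ ≤ κ₀ / (4 * (n : ℝ))) :
    VertexFamily (vertexOfM (coDressKBmAt (ctr 4 n) n (KInvStep (d := 3) n 0)) n (symHessFFAt (ctr 4 n) n)) n
      (4 * ((CΦ * ((n : ℝ) ^ 5)⁻¹ * ((n : ℝ) ^ 3)⁻¹ * Real.exp κ₀)
        * (2 * (ell (3 + 1) n : ℝ) ^ 2 * Real.exp (4 * ((3 : ℝ) + 1) * n * δ)) * Zl 4 (δ / 2))) (δ / 2) := by
  have h := vertexFamily_vertexOfM_K₀_symHessFFAt_record n hκ₀ hΦ hδ hδ₀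
  have e : vertexOfM (coDressKBmAt (ctr 4 n) n (KInvStep (d := 3) n 0)) n (symHessFFAt (ctr 4 n) n)
      = vertexOfM (KInvStep (d := 3) n 0) n (symHessFFAt (ctr 4 n) n) := by
    funext μ y x z a b
    simp only [SecondOrderResponse.vertexOfM]
    refine Finset.sum_congr rfl fun ρ' _ => ?_
    have hc : colM (coDressKBmAt (ctr 4 n) n (KInvStep (d := 3) n 0)) n μ y ρ' = colM (KInvStep (d := 3) n 0) n μ y ρ' :=
      funext fun w => colM_coDressKBmAt _ _ _ _ _ _ _
    rw [hc]
  rw [e]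
  exact h

end Summit.QuantumFields.BalabanUV.Beta.D1BFx.RoadPinVertexFamilies

end
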